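import Summits.ResolutionOfSingularities.ResolutionOfSingularities.Theorems.PurelyInseparableDim4IsolationConverse
import Literature.RingTheory.MvPolynomial.VariableIdeals
import HarnessLib
import HarnessLib.Audit.Tags

/-!
# Purely inseparable fourfolds — the F4-S and F4-C kill certificates go UP under extension of the field
# [OURS · counted 0 · statements about OUR frame (`PurelyInseparableDim4Scope`), not about resolution]

Census cell «res-dim4-pi» (D-0157 DOOR 2), width seat `res-dim4-p-14`, brick PR-12i; completes the
base-change table begun in PR-12b (`IsTrap` goes up) and PR-12f (isolated self-sustaining sets go up):
along any homomorphism of fields `f : k →+* K`, `s ↦ s♯ = (F ⊗ K, r, exc)`,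

* §1 SPINE: `spineEdge_map` (a spine edge `b = 0` over `k` is a spine edge over `K`), **`spineTrap_image`**
  (the F4-S kill shape of `FrameTraps.not_spineTerminatesSomeRule_iff_exists_spineTrap` goes up);
* §2 SCOPE: `comap_le_originIdeal`, `map_span_X`, **`inCoordinateScope_map`**
  (`InCoordinateScope q F → InCoordinateScope q (F ⊗ K)`: a minimal prime `Q` of `J_q⁺(F)·K[x]` inside
  `𝔪₀(K)` contracts to a prime between `J_q⁺(F)` and `𝔪₀(k)`, which contains a minimal prime of `J_q⁺(F)` —
  a coordinate ideal `(x_S)` by the hypothesis — so `(x_S)K[x]`, prime and between `J_q⁺(F ⊗ K)` and `Q`,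
  equals `Q` by minimality), hence **`inScopeTrap_image`** (the F4-C kill shape of
  `FrameTraps.not_terminatesInScope_iff_exists_inScopeTrap` goes up);
* §3 prime field: `forall_exists_spineTrap_of_zmod`, `forall_exists_inScopeTrap_of_zmod` — with PR-12b/12f,
  ALL FOUR kill certificates of the frame (`TerminatesSomeRule`, F4-S, F4-C, F4-I) found over `𝔽_p`
  hold over EVERY field of characteristic `p`.

NOT here (flagged): `InCoordinateScope` going DOWN (needs «minimal primes over `P·K[x]` contract to `P`»,
a flatness argument).  Nothing here proves resolution of singularities in dimension ≥ 4 / characteristic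
`p`; counted 0; AI work, weaker than expert review.
bears_on: LADDER-RESOLUTION:D157-DOOR2 (res-dim4-pi · PR-12i). Supports stmt-ResolutionOfSingularities-16155
(helper).
-/

set_option linter.dupNamespace false

noncomputable section

namespace Summit.ResolutionOfSingularities.ResolutionOfSingularities.Theorems.PIDim4

namespace ScopeBaseChange

open MvPolynomial
open Literature.AlgebraicGeometry.Resolution
open Literature.RingTheory.MvPolynomial (mem_idealOfVars_iff_constantCoeff_eq_zero isPrime_span_X_image)

variable {k K : Type} [Field k] [Field K] [DecidableEq k] [DecidableEq K] (f : k →+* K)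

/-! ## 1. Spine edges and spine traps go up -/

omit [DecidableEq k] [DecidableEq K] in
/-- The image of the chart origin is the chart origin. [folklore] -/
theorem comp_zero : (f ∘ (0 : Fin 4 → k)) = (0 : Fin 4 → K) := by
  funext i
  simp

/-- **Spine edges go up.** [folklore] -/
theorem spineEdge_map {q : ℕ} {S : Finset (Fin 4)} {s s' : State k} (h : SpineEdge q S s s') :
    SpineEdge q S (⟨MvPolynomial.map f s.F, s.r, s.exc⟩ : State K) ⟨MvPolynomial.map f s'.F, s'.r, s'.exc⟩ := by
  obtain ⟨j, hj, heq, hne, rfl⟩ := h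
  refine ⟨j, hj, ?_, ?_, ?_⟩
  · have h1 := (BaseChange.isEquimultiplePoint_map_ringHom_iff f q S j (0 : Fin 4 → k) s).mpr heq
    rwa [comp_zero f] at h1
  · have h2 := BaseChange.step_map f q S j (0 : Fin 4 → k) s
    rw [comp_zero f] at h2
    rw [h2]
    show MvPolynomial.map f (CentreBlowup.step q S j 0 s).F ≠ 0
    exact fun h0 => hne (MvPolynomial.map_injective f f.injective (by rw [h0, map_zero]))
  · have h2 := BaseChange.step_map f q S j (0 : Fin 4 → k) s
    rw [comp_zero f] at h2
    rw [h2]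

/-- **Spine traps go up**: the F4-S kill shape is preserved by the coefficient map. [folklore] -/
theorem spineTrap_image {q : ℕ} {T : Set (State k)}
    (hT : ∀ s ∈ T, (q : ℕ∞) ≤ CentreBlowup.ordAlong Finset.univ s.F ∧
      ∀ S, IsPermissibleCentre q S s.F → ∃ s' ∈ T, SpineEdge q S s s') :
    ∀ s ∈ (fun s : State k => (⟨MvPolynomial.map f s.F, s.r, s.exc⟩ : State K)) '' T,
      (q : ℕ∞) ≤ CentreBlowup.ordAlong Finset.univ s.F ∧
        ∀ S, IsPermissibleCentre q S s.F →
          ∃ s' ∈ (fun s : State k => (⟨MvPolynomial.map f s.F, s.r, s.exc⟩ : State K)) '' T,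
            SpineEdge q S s s' := by
  rintro _ ⟨s, hs, rfl⟩
  obtain ⟨hord, hall⟩ := hT s hs
  refine ⟨by rw [BaseChange.ordAlong_map]; exact hord, fun S hS => ?_⟩
  obtain ⟨s', hs', hedge⟩ := hall S ((BaseChange.isPermissibleCentre_map_iff f q S s.F).mp hS)
  exact ⟨_, ⟨s', hs', rfl⟩, spineEdge_map f hedge⟩

/-! ## 2. The coordinate scope goes up -/

omit [DecidableEq k] [DecidableEq K] in
/-- An ideal of `K[x]` inside `𝔪₀(K)` contracts into `𝔪₀(k)` (constant terms). [folklore] -/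
theorem comap_le_originIdeal {Q : Ideal (MvPolynomial (Fin 4) K)} (hQ : Q ≤ originIdeal K) :
    Q.comap (MvPolynomial.map f) ≤ originIdeal k := by
  intro G hG
  rw [IsolationCert.originIdeal_eq_idealOfVars, mem_idealOfVars_iff_constantCoeff_eq_zero]
  have hK := hQ (Ideal.mem_comap.mp hG)
  rw [IsolationCert.originIdeal_eq_idealOfVars, mem_idealOfVars_iff_constantCoeff_eq_zero,
    constantCoeff_map] at hK
  exact f.injective (by rw [hK, map_zero])

omit [DecidableEq k] [DecidableEq K] in
/-- `(x_S) · K[x] = (x_S)`. [folklore] -/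
theorem map_span_X (S : Finset (Fin 4)) :
    (Ideal.span ((fun i => (X i : MvPolynomial (Fin 4) k)) '' (S : Set (Fin 4)))).map (MvPolynomial.map f) =
      Ideal.span ((fun i => (X i : MvPolynomial (Fin 4) K)) '' (S : Set (Fin 4))) := by
  rw [Ideal.map_span, ← Set.image_comp]
  congr 1
  refine Set.image_congr fun i _ => ?_
  exact MvPolynomial.map_X f i

omit [DecidableEq k] [DecidableEq K] in
/-- **The coordinate scope goes UP**: if every minimal prime of `J_q⁺(F)` inside `𝔪₀` is a coordinate
ideal, the same holds after extension of the field. [folklore] -/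
theorem inCoordinateScope_map {q : ℕ} {F : MvPolynomial (Fin 4) k} (h : InCoordinateScope q F) :
    InCoordinateScope q (MvPolynomial.map f F) := by
  intro Q hQ hQm
  have hQp : Q.IsPrime := hQ.1.1
  have hJQ : singLocusIdeal q (MvPolynomial.map f F) ≤ Q := hQ.1.2
  -- contract `Q` to `k[x]`
  set P' : Ideal (MvPolynomial (Fin 4) k) := Q.comap (MvPolynomial.map f) with hP'
  haveI : P'.IsPrime := Ideal.IsPrime.comap _
  have hJP' : singLocusIdeal q F ≤ P' := by
    rw [hP', ← Ideal.map_le_iff_le_comap, ← IsolationConverse.singLocusIdeal_map]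
    exact hJQ
  have hP'm : P' ≤ originIdeal k := comap_le_originIdeal f hQm
  -- a minimal prime of `J_q⁺(F)` below `P'` is coordinate
  obtain ⟨P, hP, hPP'⟩ := Ideal.exists_minimalPrimes_le hJP'
  obtain ⟨S, rfl⟩ := h P hP (hPP'.trans hP'm)
  refine ⟨S, ?_⟩
  -- `(x_S)·K[x]` is prime, above `J_q⁺(F ⊗ K)` and below `Q`; minimality of `Q` forces equality
  have hle : Ideal.span ((fun i => (X i : MvPolynomial (Fin 4) K)) '' (S : Set (Fin 4))) ≤ Q := by
    rw [← map_span_X f S]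
    exact (Ideal.map_mono hPP').trans Ideal.map_comap_le
  have hJS : singLocusIdeal q (MvPolynomial.map f F) ≤
      Ideal.span ((fun i => (X i : MvPolynomial (Fin 4) K)) '' (S : Set (Fin 4))) := by
    rw [IsolationConverse.singLocusIdeal_map, ← map_span_X f S]
    exact Ideal.map_mono hP.1.2
  have hprime : (Ideal.span ((fun i => (X i : MvPolynomial (Fin 4) K)) '' (S : Set (Fin 4)))).IsPrime :=
    isPrime_span_X_image (S : Set (Fin 4))
  exact le_antisymm (hQ.2 ⟨hprime, hJS⟩ hle) hle

/-- **In-scope traps go up**: the F4-C kill shape (an `IsTrap` set all of whose states are in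
coordinate scope) is preserved by the coefficient map. [folklore] -/
theorem inScopeTrap_image {q : ℕ} {T : Set (State k)} (hT : IsTrap q T)
    (hsc : ∀ s ∈ T, InCoordinateScope q s.F) :
    IsTrap q ((fun s : State k => (⟨MvPolynomial.map f s.F, s.r, s.exc⟩ : State K)) '' T) ∧
      ∀ s ∈ (fun s : State k => (⟨MvPolynomial.map f s.F, s.r, s.exc⟩ : State K)) '' T,
        InCoordinateScope q s.F := by
  refine ⟨BaseChange.isTrap_image f hT, ?_⟩
  rintro _ ⟨s, hs, rfl⟩
  exact inCoordinateScope_map f (hsc s hs)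

/-! ## 3. Prime field: the F4-S / F4-C kill certificates over `𝔽_p` are universal -/

/-- A nonempty spine trap over `𝔽_p` yields one over every field of characteristic `p`. [folklore] -/
theorem forall_exists_spineTrap_of_zmod (p q : ℕ) [Fact p.Prime] {T : Set (State (ZMod p))}
    (hne : T.Nonempty)
    (hT : ∀ s ∈ T, (q : ℕ∞) ≤ CentreBlowup.ordAlong Finset.univ s.F ∧
      ∀ S, IsPermissibleCentre q S s.F → ∃ s' ∈ T, SpineEdge q S s s')
    (K : Type) [Field K] [CharP K p] [DecidableEq K] :
    ∃ T' : Set (State K), T'.Nonempty ∧ ∀ s ∈ T', (q : ℕ∞) ≤ CentreBlowup.ordAlong Finset.univ s.F ∧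
      ∀ S, IsPermissibleCentre q S s.F → ∃ s' ∈ T', SpineEdge q S s s' :=
  ⟨_, hne.image _, spineTrap_image (ZMod.castHom (dvd_refl p) K) hT⟩

/-- A nonempty in-scope trap over `𝔽_p` yields one over every field of characteristic `p`. [folklore] -/
theorem forall_exists_inScopeTrap_of_zmod (p q : ℕ) [Fact p.Prime] {T : Set (State (ZMod p))}
    (hne : T.Nonempty) (hT : IsTrap q T) (hsc : ∀ s ∈ T, InCoordinateScope q s.F)
    (K : Type) [Field K] [CharP K p] [DecidableEq K] :
    ∃ T' : Set (State K), T'.Nonempty ∧ IsTrap q T' ∧ ∀ s ∈ T', InCoordinateScope q s.F :=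
  ⟨_, hne.image _, inScopeTrap_image (ZMod.castHom (dvd_refl p) K) hT hsc⟩

/-- One field suffices to refute F4-S. [folklore] -/
theorem not_spineTerminatesSomeRule_of_spineTrap {p q : ℕ} {K : Type} [Field K] [CharP K p]
    [DecidableEq K] {T : Set (State K)} (hne : T.Nonempty)
    (hT : ∀ s ∈ T, (q : ℕ∞) ≤ CentreBlowup.ordAlong Finset.univ s.F ∧
      ∀ S, IsPermissibleCentre q S s.F → ∃ s' ∈ T, SpineEdge q S s s') :
    ¬ SpineTerminatesSomeRule p q :=
  (FrameTraps.not_spineTerminatesSomeRule_iff_exists_spineTrap p q).mpr ⟨K, ‹_›, ‹_›, ‹_›, T, hne, hT⟩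

/-- One field suffices to refute F4-C. [folklore] -/
theorem not_terminatesInScope_of_inScopeTrap {p q : ℕ} {K : Type} [Field K] [CharP K p]
    [DecidableEq K] {T : Set (State K)} (hne : T.Nonempty) (hT : IsTrap q T)
    (hsc : ∀ s ∈ T, InCoordinateScope q s.F) : ¬ TerminatesInScope p q :=
  (FrameTraps.not_terminatesInScope_iff_exists_inScopeTrap p q).mpr ⟨K, ‹_›, ‹_›, ‹_›, T, hne, hT, hsc⟩

end ScopeBaseChange

end Summit.ResolutionOfSingularities.ResolutionOfSingularities.Theorems.PIDim4

end
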